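import Literature.NumberTheory.Sieve.FordMaynardSliceBlocks
import Literature.Analysis.SpecialFunctions.SelbergLimit
import Mathlib.Data.Fin.Tuple.Sort
import HarnessLib

/-!
# Route `FordMaynardSieveConst01651`, target `SieveConst01651` (stmt-Parity-19185), line `sieve_decomposition`,
# stub `stub_coneCertClosed`: chamber symmetrisation of slice integrals (importable)

Helper file (def-free).  K. Ford, J. Maynard, *On the theory of prime producing sieves*, arXiv:2407.14368,
Theorem 7.3 (a) integrates over the ORDERED chamber `x₁ ≤ ⋯ ≤ x_k` of the slice `|x| = 1`; for permutation
invariant integrands this is `1/k!` of the integral over the whole slice: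

* `chamber_symm'` — for `Φ` on `ℝ^k` measurable, bounded and permutation invariant,
  `∫_{|u| = w} Φ = k! · ∫_{|u| = w} 𝟙[u monotone] Φ` (the ties `uᵢ = uⱼ`, `u_j = w − ∑ u` are Lebesgue-null —
  tree `Selberg.volume_setOf_apply_eq` and `volume_tie_last_eq_zero'` —, a tie-free slice point has
  exactly one sorting permutation, the chambers `{v ∘ σ monotone}` are measurable — `measurableSet_monotone_comp'` —
  and the slice measure is permutation invariant, tree `sliceIntegral_comp_perm`).

ADAPTED FROM the line-writer's non-importable skeleton `Cruxes/SieveConst01651/Lines/sieve_decomposition.lean`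
(planner-linewriter-parity-smallroutes-1 g0, v19: `volume_tie_last_eq_zero`, `measurableSet_monotone_comp`,
`chamber_symm_all`) so that Theorems files can import it.

References: [FordMaynard2024PrimeSieves] arXiv:2407.14368, Theorem 7.3 (a), §4.2 (Notational convention).
-/

noncomputable section

open MeasureTheory Set Finset
open scoped Classical
open Literature.NumberTheory.Sieve Literature.NumberTheory.Sieve.FordMaynard

namespace Summit.Parity.GeneralizedHardyLittlewood.FordMaynardSieveConst01651SieveConst01651

/-! ### Chamber symmetrisation of slice integrals (adapted from the skeleton, v19) -/

/-- Ties between a free coordinate and the dependent last coordinate are Lebesgue-null: the level set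
`{u | u_j + ∑ u = w}` of a non-zero linear functional is a translate of a proper submodule. [folklore] -/
theorem volume_tie_last_eq_zero' {d : ℕ} (w : ℝ) (j : Fin d) :
    volume {u : Fin d → ℝ | u j = w - ∑ i, u i} = 0 := by
  -- adapted from Lines/sieve_decomposition.lean (`volume_tie_last_eq_zero`, `volume_levelSet_eq_zero`)
  set ℓ : (Fin d → ℝ) →ₗ[ℝ] ℝ :=
    (LinearMap.proj j : (Fin d → ℝ) →ₗ[ℝ] ℝ) + ∑ i, (LinearMap.proj i : (Fin d → ℝ) →ₗ[ℝ] ℝ) with hℓdef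
  have hℓ : ℓ ≠ 0 := by
    intro h0
    have := LinearMap.congr_fun h0 (Pi.single j (1 : ℝ))
    simp only [hℓdef, LinearMap.add_apply, LinearMap.coe_proj, Function.eval, Pi.single_eq_same,
      LinearMap.sum_apply, LinearMap.zero_apply] at this
    rw [Finset.sum_pi_single'] at this
    simp at this
  have hset : {u : Fin d → ℝ | u j = w - ∑ i, u i} = {u : Fin d → ℝ | ℓ u = w} := by
    ext u
    simp only [Set.mem_setOf_eq, hℓdef, LinearMap.add_apply, LinearMap.coe_proj, Function.eval, LinearMap.sum_apply]
    constructor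
    · intro h; linarith
    · intro h; linarith
  rw [hset]
  -- the level set `{ℓ = w}` is null: empty, or a translate of `ker ℓ ≠ ⊤`
  by_cases hne : ∃ u₀, ℓ u₀ = w
  · obtain ⟨u₀, hu₀⟩ := hne
    have hker : LinearMap.ker ℓ ≠ ⊤ := by rwa [Ne, LinearMap.ker_eq_top]
    have hset' : {u : Fin d → ℝ | ℓ u = w} = (fun u => -u₀ + u) ⁻¹' (LinearMap.ker ℓ : Set (Fin d → ℝ)) := by
      ext u
      simp only [Set.mem_setOf_eq, Set.mem_preimage, SetLike.mem_coe, LinearMap.mem_ker, map_add, map_neg, hu₀]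
      constructor
      · intro h; rw [h]; ring
      · intro h; linarith
    rw [hset', measure_preimage_add]
    exact Measure.addHaar_submodule volume _ hker
  · have : {u : Fin d → ℝ | ℓ u = w} = ∅ := by
      ext u; simp only [Set.mem_setOf_eq, Set.mem_empty_iff_false, iff_false]
      exact fun h => hne ⟨u, h⟩
    rw [this, measure_empty]

/-- The chamber `{v | v ∘ σ monotone}` is measurable. [folklore] -/
theorem measurableSet_monotone_comp' (m : ℕ) (σ : Equiv.Perm (Fin m)) :
    MeasurableSet {v : Fin m → ℝ | Monotone (v ∘ σ)} := by
  -- adapted from Lines/sieve_decomposition.lean (`measurableSet_monotone_comp`)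
  have : {v : Fin m → ℝ | Monotone (v ∘ σ)} = ⋂ i, ⋂ j, {v | i ≤ j → v (σ i) ≤ v (σ j)} := by
    ext v; simp [Monotone, Set.mem_iInter]
  rw [this]
  refine MeasurableSet.iInter fun i => MeasurableSet.iInter fun j => ?_
  by_cases hij : i ≤ j
  · simp only [hij, true_implies]; exact measurableSet_le (measurable_pi_apply _) (measurable_pi_apply _)
  · simp [hij]

/-- **Chamber symmetrisation of slice integrals.** For `Φ` on `ℝ^k` measurable, bounded and invariant under
permutations of the coordinates, `∫_{|u| = w} Φ(u) du = k! · ∫_{|u| = w} 𝟙[u₁ ≤ ⋯ ≤ u_k] Φ(u) du`: the ties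
`uᵢ = uⱼ` are null, off the ties exactly one permutation sorts `u`, and the slice measure is permutation invariant
(`sliceIntegral_comp_perm`).  This turns the ORDERED integrals of Theorem 7.3 (a) into symmetric ones.
[cite: FordMaynard2024PrimeSieves, Theorem 7.3 (a) (integration over x₁ ≤ ⋯ ≤ x_k) with §4.2] -/
theorem chamber_symm' (k : ℕ) (w M : ℝ) (Φ : (Fin k → ℝ) → ℝ) (hΦm : Measurable Φ) (hΦb : ∀ u, |Φ u| ≤ M)
    (hΦs : ∀ (σ : Equiv.Perm (Fin k)) (u : Fin k → ℝ), Φ (u ∘ σ) = Φ u) :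
    sliceIntegral k w Φ = (k.factorial : ℝ) * sliceIntegral k w (fun u => if Monotone u then Φ u else 0) := by
  -- adapted from Lines/sieve_decomposition.lean (`chamber_symm_all`, planner-linewriter-parity-smallroutes-1 g0, v19)
  cases k with
  | zero => simp [sliceIntegral]
  | succ d =>
    have hM0 : 0 ≤ M := (abs_nonneg _).trans (hΦb fun _ => 0)
    have h1 : ∀ σ : Equiv.Perm (Fin (d + 1)),
        sliceIntegral (d + 1) w (fun v => if Monotone (v ∘ σ) then Φ v else 0) =
          sliceIntegral (d + 1) w (fun u => if Monotone u then Φ u else 0) := by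
      intro σ
      have : (fun v : Fin (d + 1) → ℝ => if Monotone (v ∘ σ) then Φ v else 0) =
          fun v => (fun u : Fin (d + 1) → ℝ => if Monotone u then Φ u else 0) (v ∘ σ) := by
        funext v; simp only [hΦs σ v]
      rw [this]
      exact sliceIntegral_comp_perm w σ (fun u => if Monotone u then Φ u else 0)
    set T : Set (Fin d → ℝ) :=
      (⋃ p : Fin d × Fin d, if p.1 ≠ p.2 then {u | u p.1 = u p.2} else ∅) ∪ ⋃ j : Fin d, {u | u j = w - ∑ i, u i}
      with hT
    have hT0 : volume T = 0 := by
      rw [hT]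
      refine measure_union_null (measure_iUnion_null fun p => ?_)
        (measure_iUnion_null fun j => volume_tie_last_eq_zero' w j)
      by_cases hp : p.1 ≠ p.2
      · rw [if_pos hp]; exact Literature.Analysis.SpecialFunctions.Selberg.volume_setOf_apply_eq hp
      · rw [if_neg hp]; exact measure_empty
    have hinj : ∀ u : Fin d → ℝ, u ∉ T → Function.Injective (Fin.snoc u (w - ∑ i, u i) : Fin (d + 1) → ℝ) := by
      intro u hu a b hab
      by_contra hne
      apply hu
      rw [hT]
      induction a using Fin.lastCases with
      | last =>
        induction b using Fin.lastCases with
        | last => exact absurd rfl hne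
        | cast b' =>
          refine Set.mem_union_right _ (Set.mem_iUnion.mpr ⟨b', ?_⟩)
          simp only [Fin.snoc_last, Fin.snoc_castSucc] at hab
          exact hab.symm
      | cast a' =>
        induction b using Fin.lastCases with
        | last =>
          refine Set.mem_union_right _ (Set.mem_iUnion.mpr ⟨a', ?_⟩)
          simp only [Fin.snoc_last, Fin.snoc_castSucc] at hab
          exact hab
        | cast b' =>
          have hab' : a' ≠ b' := fun h => hne (by rw [h])
          refine Set.mem_union_left _ (Set.mem_iUnion.mpr ⟨(a', b'), ?_⟩)
          simp only [Fin.snoc_castSucc] at hab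
          simp only [ne_eq, hab', not_false_eq_true, if_true, Set.mem_setOf_eq]
          exact hab
    have hpt : ∀ u : Fin d → ℝ, u ∉ T →
        sliceIntegrand d w Φ u = ∑ σ : Equiv.Perm (Fin (d + 1)),
          sliceIntegrand d w (fun v => if Monotone (v ∘ σ) then Φ v else 0) u := by
      intro u hu
      unfold sliceIntegrand
      by_cases hc : (∀ i, 0 < u i) ∧ ∑ i, u i < w
      · simp only [if_pos hc]
        set x : Fin (d + 1) → ℝ := Fin.snoc u (w - ∑ i, u i) with hx
        have hxi : Function.Injective x := hinj u hu
        rw [Finset.sum_eq_single (Tuple.sort x)]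
        · rw [if_pos (Tuple.monotone_sort x)]
        · intro τ _ hτ
          rw [if_neg]
          intro hmono
          apply hτ
          have heq := Tuple.unique_monotone hmono (Tuple.monotone_sort x)
          exact Equiv.ext fun i => hxi (congr_fun heq i)
        · intro h; exact absurd (Finset.mem_univ _) h
      · simp only [if_neg hc, Finset.sum_const_zero]
    have hint : ∀ σ : Equiv.Perm (Fin (d + 1)),
        Integrable (sliceIntegrand d w (fun v => if Monotone (v ∘ σ) then Φ v else 0)) := by
      intro σ
      refine integrable_sliceIntegrand d w ?_ hM0 fun v _ _ => ?_
      · exact Measurable.ite (measurableSet_monotone_comp' (d + 1) σ) hΦm measurable_const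
      · split_ifs
        · exact hΦb v
        · rw [abs_zero]; exact hM0
    have h2 : sliceIntegral (d + 1) w Φ = ∑ σ : Equiv.Perm (Fin (d + 1)),
        sliceIntegral (d + 1) w (fun v => if Monotone (v ∘ σ) then Φ v else 0) := by
      simp only [sliceIntegral_succ_eq]
      rw [← integral_finsetSum _ fun σ _ => hint σ]
      refine integral_congr_ae ?_
      have hae : ∀ᵐ u ∂(volume : Measure (Fin d → ℝ)), u ∉ T := by
        rw [ae_iff]; simpa using hT0
      exact hae.mono fun u hu => hpt u hu
    rw [h2, Finset.sum_congr rfl fun σ _ => h1 σ, Finset.sum_const, Finset.card_univ, Fintype.card_perm,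
      Fintype.card_fin, nsmul_eq_mul]

end Summit.Parity.GeneralizedHardyLittlewood.FordMaynardSieveConst01651SieveConst01651

end
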